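import Summits.PneNP.PneNP.Theorems.ReslinSizeFromWidthTreeLike
import Summits.PneNP.PneNP.Theorems.ReslinSizeFromWidthClauseSpace
import Literature.Computability.MetaComplexity.ResLinWidthLifting
import Literature.Computability.MetaComplexity.ResLinGaussianWidth
import Literature.Computability.MetaComplexity.LinearMapResolutionWidthProofs

/-!
# PneNP / ReslinSizeFromWidth — lifted width-hard CNFs on the Res(⊕) ladder (rung 7: width lifting)

Route `PneNP/ReslinSizeFromWidth`, crux X1 = `Summit.PneNP.PneNP.Theses.ReslinSizeFromWidth.ResLinSizeFromWidth`
(stmt-PneNP-18932, the Itsykson–Sokolov open problem in size-from-width form; NOT claimed here).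
This file feeds the ladder built under that crux (rank input → quadratic dag-like size, gen 2 →
exponential tree-like size, gen 3 → linear clause space, gen 4) with the RANK INPUT supplied by the
width-lifting theorem of Alekseev–Itsykson (STOC 2025, Thm 1.1 = 3.1), reproduced in
`Literature.Computability.MetaComplexity.ResLinWidthLifting`
(`lt_resLinWidth_gadgetLift_of_forall_lt_resWidth`): if every resolution refutation of `φ` has width
`> w` and `g : {0,1}^a → {0,1}` is 1-stifling, every Res(⊕) refutation (semantic weakening) of
`φ ∘ g = gadgetLift a g φ` has a line of rank `> w`.

Consequences recorded here (all one-line compositions of landed theorems; `φ` a `t`-CNF, so `φ ∘ g`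
is a `ta`-CNF by `isWidthLE_gadgetLift`):
* `B_le_length_gadgetLift` / `quadratic_le_length_gadgetLift` — every dag-like Res(⊕) refutation of
  `φ ∘ g` has `≥ B (ta) w = 1 + Σ_{s=ta+1}^{w} s` lines (gen-2 law `ResLinSW.B_le_length_of_isResLinRefutation`);
* `pow_le_length_gadgetLift_treeLike` — every tree-like one has `≥ 2^(w − ta)` lines (gen-3 law);
* `clauseSpace_gadgetLift` — every configuration-style one has clause space `≥ w + 2 − ta` (gen-4 law,
  GOR 2024 Thm 6);
* `resLinWidth_gadgetLift_sumEncoding` — LIFTED EXPANDING XOR-SYSTEMS: for an `ℓ`-sparse unsolvable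
  `𝔽₂`-system `E` whose row supports form an `(r, 3ℓ/4)`-boundary expander, every Res(⊕) refutation of
  `sumEncoding 1 E ∘ g` (the canonical XOR-CNF of `E`, Krajíček's `¬τ_b(A)`, lifted) has rank-width
  `≥ r/4` — Krajíček 2019 Lemma 13.4.5 (tree: `Krajicek2019_lemma_13_4_5_holds`, resolution width
  `≥ r/4`) composed with the lifting theorem; with `MAJ₃`: `resLinWidth_maj3Lift_sumEncoding`, and the
  quadratic size bound `B_le_length_maj3Lift_sumEncoding`;
* `liftingGap_sumEncoding` — THE GAP, both sides kernel-checked: UNLIFTED, the same XOR-CNF has a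
  Res(⊕) refutation of rank-width `≤ max ℓ 2` (Gaussian elimination inside Res(⊕),
  `minResLinWidth_sumEncoding_le`, `ResLinGaussianWidth.lean`), LIFTED by any 1-stifling gadget
  every Res(⊕) refutation has rank-width `≥ r/4` — so the gadget is what the theorem is about
  (lifted Tseitin / XOR formulas of this kind are the hard instances of Efremenko–Garlík–Itsykson
  2024, Alekseev–Itsykson 2025, Bhattacharya–Byramji–Chattopadhyay–Impagliazzo 2026).

Honest label: REPRODUCTION + bookkeeping. Nothing superquadratic, nothing about bounded depth, and
the crux X1 is untouched.

References: Y. Alekseev, D. Itsykson, STOC 2025, Thm 1.1/3.1; J. Krajíček, *Proof Complexity*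
(CUP 2019), Lemma 13.4.5; S. Gryaznov, S. Ovcharov, A. Riazanov, ACM ToCT 2024, Thm 6.
-/

namespace Summit.PneNP.PneNP.Theorems

-- `Summit.PneNP.PneNP` repeats a path component by design (summit = sub-problem); silence the linter.
set_option linter.dupNamespace false

open Literature.Computability.Complexity Literature.Computability.MetaComplexity

section Lifting

variable {a : ℕ} {g : (Fin a → Bool) → Bool} {φ : CNF ℕ} {t w : ℕ}

/-- **Rank input from width lifting** (Alekseev–Itsykson 2025 Thm 3.1, tree
`lt_resLinWidth_gadgetLift_of_forall_lt_resWidth`), in the `k ≤ resLinWidth` form the ladder laws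
consume: resolution width `> w` for `φ` and `g` 1-stifling give Res(⊕) rank-width `≥ w + 1` for
every refutation of `φ ∘ g`. -/
theorem succ_le_resLinWidth_gadgetLift (ha : 0 < a) (hg : IsStifling g)
    (hφ : ∀ π : List (ResLine ℕ), IsResRefutation φ π → w < resWidth π) :
    ∀ π : List ResLinLine, IsResLinRefutation (gadgetLift a g φ) π → w + 1 ≤ resLinWidth π :=
  fun _ hπ => lt_resLinWidth_gadgetLift_of_forall_lt_resWidth ha hg hφ hπ

/-- **Quadratic dag-like size for lifted width-hard CNFs.** If `φ` is a `t`-CNF every resolution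
refutation of which has width `> w`, and `g : {0,1}^a → {0,1}` is 1-stifling, then every dag-like
Res(⊕) refutation (semantic weakening) of `φ ∘ g` has at least `B (ta) w = 1 + Σ_{s=ta+1}^{w} s`
lines (gen-2 law `ResLinSW.B_le_length_of_isResLinRefutation` on the rank input of
`succ_le_resLinWidth_gadgetLift`). -/
theorem B_le_length_gadgetLift (ha : 0 < a) (hg : IsStifling g) (hφt : φ.IsWidthLE t)
    (hφ : ∀ π : List (ResLine ℕ), IsResRefutation φ π → w < resWidth π)
    {π : List ResLinLine} (hπ : IsResLinRefutation (gadgetLift a g φ) π) :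
    ResLinSW.B (t * a) w ≤ π.length := by
  have h := ResLinSW.B_le_length_of_isResLinRefutation (isWidthLE_gadgetLift hφt)
    (succ_le_resLinWidth_gadgetLift ha hg hφ) hπ
  simpa using h

/-- Closed form of the quadratic bound: `2·|π| + ta(ta+1) ≥ 2 + w(w+1)` whenever `ta ≤ w`. -/
theorem quadratic_le_length_gadgetLift (ha : 0 < a) (hg : IsStifling g) (hφt : φ.IsWidthLE t)
    (hφ : ∀ π : List (ResLine ℕ), IsResRefutation φ π → w < resWidth π) (hta : t * a ≤ w)
    {π : List ResLinLine} (hπ : IsResLinRefutation (gadgetLift a g φ) π) :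
    2 + w * (w + 1) ≤ 2 * π.length + t * a * (t * a + 1) := by
  have h := ResLinSW.quadratic_le_length_of_isResLinRefutation (isWidthLE_gadgetLift hφt)
    (succ_le_resLinWidth_gadgetLift ha hg hφ) (by omega) hπ
  simpa using h

/-- **Exponential tree-like size for lifted width-hard CNFs**: under the same hypotheses every
TREE-LIKE Res(⊕) refutation of `φ ∘ g` (each line used as a premise at most once) has at least
`2^(w − ta)` lines (gen-3 law `ResLinSW.pow_le_length_of_treeLike`). -/
theorem pow_le_length_gadgetLift_treeLike (ha : 0 < a) (hg : IsStifling g) (hφt : φ.IsWidthLE t)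
    (hφ : ∀ π : List (ResLine ℕ), IsResRefutation φ π → w < resWidth π)
    {π : List ResLinLine} (hπ : IsResLinRefutation (gadgetLift a g φ) π)
    (htree : ∀ i : ℕ, (π.map fun l => l.premises.count i).sum ≤ 1) :
    2 ^ (w - t * a) ≤ π.length := by
  have h := ResLinSW.pow_le_length_of_treeLike (isWidthLE_gadgetLift hφt)
    (succ_le_resLinWidth_gadgetLift ha hg hφ) hπ htree
  have hexp : w + 1 - t * a - 1 = w - t * a := by omega
  rw [hexp] at h
  exact h

/-- **Linear clause space for lifted width-hard CNFs**: under the same hypotheses with `ta ≤ w`,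
every configuration-style Res(⊕) refutation of `φ ∘ g` has clause space `≥ w + 2 − ta` (gen-4 law
`resLinClauseSpace_of_rank`, Gryaznov–Ovcharov–Riazanov 2024 Thm 6). -/
theorem clauseSpace_gadgetLift (ha : 0 < a) (hg : IsStifling g) (hφt : φ.IsWidthLE t)
    (hφ : ∀ π : List (ResLine ℕ), IsResRefutation φ π → w < resWidth π) (hta : t * a ≤ w)
    {ϖ : List (Finset LinClause)} (hϖ : IsResLinSpaceRefutation (gadgetLift a g φ) ϖ) :
    w + 2 - t * a ≤ resLinClauseSpace ϖ :=
  resLinClauseSpace_of_rank (isWidthLE_gadgetLift hφt) hta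
    (fun _ hπ => lt_resLinWidth_gadgetLift_of_forall_lt_resWidth ha hg hφ hπ) hϖ

end Lifting

/-! ### Lifted expanding XOR-systems -/

section ExpanderXor

variable {a : ℕ} {g : (Fin a → Bool) → Bool}

/-- **Lifted expanding XOR-systems are rank-hard for Res(⊕).** Let `E` be an unsolvable system of
`𝔽₂`-equations with row supports of size `≤ ℓ` (`ℓ ≥ 1`) forming an `(r, 3ℓ/4)`-boundary expander
(`r ≥ 1`), and `g : {0,1}^a → {0,1}` a 1-stifling gadget. Then every Res(⊕) refutation of the lifted
XOR-CNF `sumEncoding 1 E ∘ g` has a line of rank `≥ r/4` (Krajíček 2019 Lemma 13.4.5, tree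
`Krajicek2019_lemma_13_4_5_holds`: resolution width of `sumEncoding 1 E` is `≥ r/4`; then
Alekseev–Itsykson width lifting). -/
theorem resLinWidth_gadgetLift_sumEncoding (ha : 0 < a) (hg : IsStifling g) {ℓ r n m : ℕ}
    (E : Fin m → LinEqMod 2 n) (hℓ : 1 ≤ ℓ) (hr : 1 ≤ r) (hsparse : ∀ i, (E i).supp.card ≤ ℓ)
    (hexp : IsBoundaryExpander (fun i => (E i).supp.map Fin.valEmbedding) (r : ℝ) (3 / 4 * ℓ))
    (hunsat : ¬ SystemSat E Finset.univ) {π : List ResLinLine}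
    (hπ : IsResLinRefutation (gadgetLift a g (sumEncoding 1 E)) π) :
    (r : ℝ) / 4 ≤ (resLinWidth π : ℝ) := by
  -- resolution width of the XOR-CNF: `≥ ⌈r/4⌉`, i.e. `> ⌈r/4⌉ - 1`
  have hres : ∀ π₀ : List (ResLine ℕ), IsResRefutation (sumEncoding 1 E) π₀ →
      ⌈(r : ℝ) / 4⌉₊ - 1 < resWidth π₀ := by
    intro π₀ hπ₀
    have h1 : (r : ℝ) / 4 ≤ (resWidth π₀ : ℝ) :=
      Krajicek2019_lemma_13_4_5_holds ℓ r n m E hℓ hr hsparse hexp hunsat π₀ hπ₀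
    have h2 : ⌈(r : ℝ) / 4⌉₊ ≤ resWidth π₀ := Nat.ceil_le.2 h1
    have h3 : 0 < ⌈(r : ℝ) / 4⌉₊ := by
      rw [Nat.ceil_pos]
      have : (1 : ℝ) ≤ r := by exact_mod_cast hr
      linarith
    omega
  have hlift := lt_resLinWidth_gadgetLift_of_forall_lt_resWidth ha hg hres hπ
  have h4 : ⌈(r : ℝ) / 4⌉₊ ≤ resLinWidth π := by omega
  exact (Nat.le_ceil _).trans (by exact_mod_cast h4)

/-- The `MAJ₃` instance: every Res(⊕) refutation of `sumEncoding 1 E ∘ MAJ₃` (the XOR-CNF of an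
unsolvable `ℓ`-sparse `(r, 3ℓ/4)`-boundary-expanding `𝔽₂`-system, lifted by the 3-bit majority) has
a line of rank `≥ r/4`. -/
theorem resLinWidth_maj3Lift_sumEncoding {ℓ r n m : ℕ} (E : Fin m → LinEqMod 2 n) (hℓ : 1 ≤ ℓ)
    (hr : 1 ≤ r) (hsparse : ∀ i, (E i).supp.card ≤ ℓ)
    (hexp : IsBoundaryExpander (fun i => (E i).supp.map Fin.valEmbedding) (r : ℝ) (3 / 4 * ℓ))
    (hunsat : ¬ SystemSat E Finset.univ) {π : List ResLinLine}
    (hπ : IsResLinRefutation (gadgetLift 3 maj3Gadget (sumEncoding 1 E)) π) :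
    (r : ℝ) / 4 ≤ (resLinWidth π : ℝ) :=
  resLinWidth_gadgetLift_sumEncoding (by norm_num) isStifling_maj3Gadget E hℓ hr hsparse hexp hunsat hπ

/-- Quadratic dag-like size for `sumEncoding 1 E ∘ MAJ₃` (a `3ℓ`-CNF): every Res(⊕) refutation has
at least `B (3ℓ) (⌈r/4⌉ − 1) = 1 + Σ_{s=3ℓ+1}^{⌈r/4⌉−1} s` lines (gen-2 law on the rank input above).
No superquadratic statement is made. -/
theorem B_le_length_maj3Lift_sumEncoding {ℓ r n m : ℕ} (E : Fin m → LinEqMod 2 n) (hℓ : 1 ≤ ℓ)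
    (hr : 1 ≤ r) (hsparse : ∀ i, (E i).supp.card ≤ ℓ)
    (hexp : IsBoundaryExpander (fun i => (E i).supp.map Fin.valEmbedding) (r : ℝ) (3 / 4 * ℓ))
    (hunsat : ¬ SystemSat E Finset.univ) {π : List ResLinLine}
    (hπ : IsResLinRefutation (gadgetLift 3 maj3Gadget (sumEncoding 1 E)) π) :
    ResLinSW.B (ℓ * 3) (⌈(r : ℝ) / 4⌉₊ - 1) ≤ π.length := by
  have hres : ∀ π₀ : List (ResLine ℕ), IsResRefutation (sumEncoding 1 E) π₀ →
      ⌈(r : ℝ) / 4⌉₊ - 1 < resWidth π₀ := by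
    intro π₀ hπ₀
    have h1 : (r : ℝ) / 4 ≤ (resWidth π₀ : ℝ) :=
      Krajicek2019_lemma_13_4_5_holds ℓ r n m E hℓ hr hsparse hexp hunsat π₀ hπ₀
    have h2 : ⌈(r : ℝ) / 4⌉₊ ≤ resWidth π₀ := Nat.ceil_le.2 h1
    have h3 : 0 < ⌈(r : ℝ) / 4⌉₊ := by
      rw [Nat.ceil_pos]
      have : (1 : ℝ) ≤ r := by exact_mod_cast hr
      linarith
    omega
  have hwidth : (sumEncoding 1 E).IsWidthLE ℓ := by
    simpa using isWidthLE_sumEncoding 1 E hsparse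
  exact B_le_length_gadgetLift (by norm_num) isStifling_maj3Gadget hwidth hres hπ

/-- **The lifting gap for expanding XOR-systems** (both sides kernel-checked). For an unsolvable
`𝔽₂`-system `E` with rows of support `≤ ℓ` (`ℓ ≥ 1`) forming an `(r, 3ℓ/4)`-boundary expander
(`r ≥ 1`) and a 1-stifling `g : {0,1}^a → {0,1}`: the XOR-CNF `sumEncoding 1 E` itself has a Res(⊕)
refutation all of whose lines have rank `≤ max ℓ 2` (Gaussian elimination,
`minResLinWidth_sumEncoding_le`), whereas every Res(⊕) refutation of its lift
`sumEncoding 1 E ∘ g` has a line of rank `≥ r/4` (`resLinWidth_gadgetLift_sumEncoding`).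
[Itsykson–Sokolov 2020 §3; Krajíček 2019 Lemma 13.4.5; Alekseev–Itsykson 2025 Thm 3.1] -/
theorem liftingGap_sumEncoding (ha : 0 < a) (hg : IsStifling g) {ℓ r n m : ℕ}
    (E : Fin m → LinEqMod 2 n) (hℓ : 1 ≤ ℓ) (hr : 1 ≤ r) (hsparse : ∀ i, (E i).supp.card ≤ ℓ)
    (hexp : IsBoundaryExpander (fun i => (E i).supp.map Fin.valEmbedding) (r : ℝ) (3 / 4 * ℓ))
    (hunsat : ¬ SystemSat E Finset.univ) :
    (∃ π₀ : List ResLinLine, IsResLinRefutation (sumEncoding 1 E) π₀ ∧ resLinWidth π₀ ≤ max ℓ 2) ∧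
      ∀ π : List ResLinLine, IsResLinRefutation (gadgetLift a g (sumEncoding 1 E)) π →
        (r : ℝ) / 4 ≤ (resLinWidth π : ℝ) := by
  refine ⟨?_, fun π hπ => resLinWidth_gadgetLift_sumEncoding ha hg E hℓ hr hsparse hexp hunsat hπ⟩
  obtain ⟨π₀, hπ₀, -, hw⟩ := exists_isResLinRefutation_sumEncoding_narrow E hsparse hunsat
  exact ⟨π₀, hπ₀, hw⟩

end ExpanderXor

end Summit.PneNP.PneNP.Theorems
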